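import Mathlib.Analysis.SpecialFunctions.Pow.Real
import Mathlib.Analysis.Complex.ExponentialBounds
import Mathlib.Analysis.Real.Pi.Bounds
import Summits.RiemannHypothesis.RiemannHypothesis.Theorems.LiCoefficientsDefs
import HarnessLib

/-!
# RiemannHypothesis / LiCoefficients — crux `LiHeightBudget` (RH-FREE; the closed real inequality)

Route `RiemannHypothesis/LiCoefficients` (cell `pub/rh-li`, D-0059/D-0061), item `LiHeightBudget` (L6 of the theory
memo `theory/TARGETS.md` §8.1): for `T ≥ 10⁵`, `2π(T − 4) < n ≤ T²/5` and `T₂ = min(T, n/13)`,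

  `0 ≤ 2 · liWindowBound n T₂ − 2.82 n² log T/(6π T³)`.

Two regimes (as in the theory skeleton `Lines/two-regimes`): (A) `13T ≤ n`, `T₂ = T`: every `n`-dependent
term is monotone, so it suffices to bound `T²/n ≤ T/13`, `n/T² ≤ 1/5`, `n²/T³ ≤ T/25`, after which the budget is
`≥ 0.0737·T·L − 0.491·T − 2.69·L − 36.7 ≥ 0` for `L = log(T/2π) ≥ 9`, `T ≥ 10⁵`; (B) `n < 13T`, `T₂ = n/13`:
the window terms become `n·(0.0040·L − 0.0019) − …`, the far term is an absolute constant `≤ 25.3`, and the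
budget is `≥ 0.060·n − 79 > 0`.  Only crude logarithm bounds are needed (`log 2π ≤ 2`, `e⁸ ≤ 2981`, `e⁹ ≤ 8104`).
RH-FREE [rh-li-prover]: pure real arithmetic, part of the PROOF-OF-DATA rung L-P(P1) of the RH ladder's column LI;
nothing here bears on the truth of RH.
-/

noncomputable section

-- D-0017: `Summit.<S>.<S>.…` is the designed namespace of a single-problem summit.
set_option linter.dupNamespace false

open Real
open scoped Real

namespace Summit.RiemannHypothesis.RiemannHypothesis.Theorems.LiTheory

namespace Budget

/-! ### Numerical constants -/

/-- `e⁸ ≤ 2981`. -/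
theorem exp_eight_le : Real.exp 8 ≤ 2981 := by
  have he := Real.exp_one_lt_d9
  have h : Real.exp 8 = Real.exp 1 ^ 8 := by rw [← Real.exp_nat_mul]; norm_num
  rw [h]
  have := pow_le_pow_left₀ (Real.exp_pos 1).le he.le 8
  exact this.trans (by norm_num)

/-- `e⁹ ≤ 8104`. -/
theorem exp_nine_le : Real.exp 9 ≤ 8104 := by
  have he := Real.exp_one_lt_d9
  have h : Real.exp 9 = Real.exp 1 ^ 9 := by rw [← Real.exp_nat_mul]; norm_num
  rw [h]
  have := pow_le_pow_left₀ (Real.exp_pos 1).le he.le 9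
  exact this.trans (by norm_num)

/-- Crude bounds `0 ≤ log(2π) ≤ 2`. -/
theorem log_two_pi_crude : 0 ≤ Real.log (2 * π) ∧ Real.log (2 * π) ≤ 2 := by
  have hπ := Real.pi_lt_d2
  have hπ' := Real.pi_gt_d2
  have he := Real.exp_one_gt_d9
  refine ⟨Real.log_nonneg (by linarith), ?_⟩
  rw [Real.log_le_iff_le_exp (by positivity)]
  have h2 : Real.exp 2 = Real.exp 1 * Real.exp 1 := by rw [← Real.exp_add]; norm_num
  rw [h2]
  nlinarith

/-! ### Regime A: `13T ≤ n ≤ T²/5`, `T₂ = T` (variables `ν = n`, `L = log(T/2π)`, `ℓ = log T`) -/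

/-- `L = log(T/2π) ≥ 9` for `T ≥ 10⁵`. -/
theorem nine_le_L {T : ℝ} (hT : (10 : ℝ) ^ 5 ≤ T) : 9 ≤ Real.log (T / (2 * π)) := by
  have hπhi := Real.pi_lt_d4
  rw [Real.le_log_iff_exp_le (by positivity), le_div_iff₀ (by positivity)]
  have h := mul_le_mul exp_nine_le (show 2 * π ≤ 2 * 3.1416 by linarith) (by positivity) (by norm_num)
  linarith

/-- Main term, regime A: `T/(4π)(L − 0.31) ≥ 0.0795 TL − 0.024645 T` (`L ≥ 0.31`). -/
theorem mainA {T L : ℝ} (hT : 0 < T) (hL : 0.31 ≤ L) :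
    0.0795 * (T * L) - 0.024645 * T ≤ T / (4 * π) * (L - 0.31) := by
  have hπhi := Real.pi_lt_d4
  have h1 : 0.0795 * T ≤ T / (4 * π) := by
    rw [le_div_iff₀ (by positivity)]; nlinarith
  have h2 : 0 ≤ L - 0.31 := by linarith
  linarith [mul_le_mul_of_nonneg_right h1 h2]

/-- Second term, regime A: `0.36 (T²/ν) L ≤ 0.0277 TL` when `13T ≤ ν`. -/
theorem secA {T L ν : ℝ} (hT : 0 < T) (hL : 0 ≤ L) (h13 : 13 * T ≤ ν) :
    0.36 * (T ^ 2 / ν) * L ≤ 0.0277 * (T * L) := by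
  have hν0 : 0 < ν := by linarith
  have hb1 : T ^ 2 / ν ≤ T / 13 := by
    rw [div_le_div_iff₀ hν0 (by norm_num)]; nlinarith
  have := mul_le_mul_of_nonneg_right (mul_le_mul_of_nonneg_left hb1 (by norm_num : (0:ℝ) ≤ 0.36)) hL
  nlinarith

/-- `S`-terms, regime A: `(2.30 + 0.128L)(4ν/T² + (7/3)ν²/T³) ≤ 1.84 + 0.1024L + (161/750)T + (112/9375)TL`
when `0 ≤ ν ≤ T²/5`. -/
theorem sA {T L ν : ℝ} (hT : 0 < T) (hL : 0 ≤ L) (hν0 : 0 ≤ ν) (hn : ν ≤ 1 / 5 * T ^ 2) :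
    (2.30 + 0.128 * L) * (4 * ν / T ^ 2 + 7 / 3 * ν ^ 2 / T ^ 3) ≤
      1.84 + 0.1024 * L + 161 / 750 * T + 112 / 9375 * (T * L) := by
  have hν2 : ν ^ 2 ≤ T ^ 4 / 25 := by
    have : ν ^ 2 ≤ (1 / 5 * T ^ 2) ^ 2 := pow_le_pow_left₀ hν0 hn 2
    nlinarith
  have hb2a : 4 * ν / T ^ 2 ≤ 4 / 5 := by
    rw [div_le_iff₀ (by positivity)]; nlinarith
  have hb2b : 7 / 3 * ν ^ 2 / T ^ 3 ≤ 7 / 75 * T := by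
    rw [div_le_iff₀ (by positivity)]
    have : T ^ 4 = T * T ^ 3 := by ring
    nlinarith
  have hcoef : 0 ≤ 2.30 + 0.128 * L := by positivity
  have := mul_le_mul_of_nonneg_left (add_le_add hb2a hb2b) hcoef
  have e : (2.30 + 0.128 * L) * (4 / 5 + 7 / 75 * T) =
      1.84 + 0.1024 * L + 161 / 750 * T + 112 / 9375 * (T * L) := by ring
  linarith

/-- Far term, regime A: `2.82 ν² ℓ/(6πT³) ≤ 0.006 TL + 0.012 T` when `0 ≤ ν ≤ T²/5`, `0 ≤ ℓ ≤ L + 2`. -/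
theorem farA {T L ℓ ν : ℝ} (hT : 0 < T) (hℓ0 : 0 ≤ ℓ) (hℓle : ℓ ≤ L + 2) (hν0 : 0 ≤ ν)
    (hn : ν ≤ 1 / 5 * T ^ 2) :
    2.82 * ν ^ 2 * (ℓ / (6 * π * T ^ 3)) ≤ 0.006 * (T * L) + 0.012 * T := by
  have hπlo := Real.pi_gt_d4
  have hν2 : ν ^ 2 ≤ T ^ 4 / 25 := by
    have : ν ^ 2 ≤ (1 / 5 * T ^ 2) ^ 2 := pow_le_pow_left₀ hν0 hn 2
    nlinarith
  have h1 : 2.82 * ν ^ 2 * (ℓ / (6 * π * T ^ 3)) ≤ 2.82 * (T ^ 4 / 25) * (ℓ / (6 * π * T ^ 3)) :=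
    mul_le_mul_of_nonneg_right (mul_le_mul_of_nonneg_left hν2 (by norm_num)) (by positivity)
  have e : 2.82 * (T ^ 4 / 25) * (ℓ / (6 * π * T ^ 3)) = 2.82 / (150 * π) * (T * ℓ) := by
    field_simp
    ring
  have h3 : 2.82 / (150 * π) ≤ 0.006 := by
    rw [div_le_iff₀ (by positivity)]; nlinarith
  have h4 : 0 ≤ T * ℓ := by positivity
  have h5 : T * ℓ ≤ T * L + 2 * T := by nlinarith [mul_le_mul_of_nonneg_left hℓle hT.le]
  nlinarith [mul_le_mul_of_nonneg_right h3 h4]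

/-- REGIME A (`13T ≤ n ≤ T²/5`, window top `T₂ = T`). -/
theorem caseA (n : ℕ) (T : ℝ) (hT : (10 : ℝ) ^ 5 ≤ T) (h13 : 13 * T ≤ n) (hn : (n : ℝ) ≤ 1 / 5 * T ^ 2) :
    0 ≤ 2 * liWindowBound n T - 2.82 * (n : ℝ) ^ 2 * (Real.log T / (6 * Real.pi * T ^ 3)) := by
  have hT0 : 0 < T := by linarith [show (0 : ℝ) < 10 ^ 5 by norm_num]
  unfold liWindowBound
  set ν : ℝ := (n : ℝ) with hν
  set L : ℝ := Real.log (T / (2 * π)) with hL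
  set ℓ : ℝ := Real.log T with hℓ
  have hν0 : 0 ≤ ν := by linarith
  have hℓL : ℓ = L + Real.log (2 * π) := by
    rw [hL, Real.log_div hT0.ne' (by positivity)]; ring
  have hL9 : 9 ≤ L := nine_le_L hT
  have hℓle : ℓ ≤ L + 2 := by linarith [log_two_pi_crude.2]
  have hℓ0 : 0 ≤ ℓ := by linarith [log_two_pi_crude.1]
  have hmain := mainA hT0 (show (0.31 : ℝ) ≤ L by linarith)
  have hsec := secA hT0 (by linarith : 0 ≤ L) h13
  have hS := sA hT0 (by linarith : 0 ≤ L) hν0 hn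
  have hfar := farA hT0 hℓ0 hℓle hν0 hn
  have hprod : 9 * T + 40 * L - 360 ≤ T * L := by
    nlinarith [mul_nonneg (show (0:ℝ) ≤ T - 40 by linarith) (show (0:ℝ) ≤ L - 9 by linarith)]
  linarith only [hmain, hsec, hS, hfar, hprod, hℓle, hℓ0, hT, hL9]

/-! ### Regime B: `2π(T − 4) < n < 13T`, `T₂ = n/13` (variables `ν = n`, `L = log(ν/13/2π)`) -/

/-- `L = log(ν/13/2π) ≥ 8` for `ν ≥ 628000`. -/
theorem eight_le_L {ν : ℝ} (hν : 628000 ≤ ν) : 8 ≤ Real.log (ν / 13 / (2 * π)) := by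
  have hπhi := Real.pi_lt_d4
  rw [Real.le_log_iff_exp_le (by positivity), le_div_iff₀ (by positivity),
    le_div_iff₀ (by norm_num)]
  have h := mul_le_mul exp_eight_le (show 2 * π ≤ 2 * 3.1416 by linarith) (by positivity) (by norm_num)
  have h' := mul_le_mul_of_nonneg_right h (show (0:ℝ) ≤ 13 by norm_num)
  linarith

/-- Main term, regime B: `(ν/13)/(4π)(L − 0.31) ≥ 0.00612 νL − 0.0018972 ν` (`L ≥ 0.31`). -/
theorem mainB {ν L : ℝ} (hν : 0 < ν) (hL : 0.31 ≤ L) :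
    0.00612 * (ν * L) - 0.0018972 * ν ≤ ν / 13 / (4 * π) * (L - 0.31) := by
  have hπhi := Real.pi_lt_d4
  have h1 : 0.00612 * ν ≤ ν / 13 / (4 * π) := by
    rw [div_div, le_div_iff₀ (by positivity)]; nlinarith
  have h2 : 0 ≤ L - 0.31 := by linarith
  linarith [mul_le_mul_of_nonneg_right h1 h2]

/-- `S`-terms, regime B: `(2.30 + 0.128L)(676/ν + 15379/(3ν)) ≤ 0.0213 + 0.00119 L` for `ν ≥ 628000`. -/
theorem sB {ν L : ℝ} (hν : 628000 ≤ ν) (hL : 0 ≤ L) :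
    (2.30 + 0.128 * L) * (676 / ν + 15379 / (3 * ν)) ≤ 0.0213 + 0.00119 * L := by
  have hν0 : 0 < ν := by linarith
  have h1 : 676 / ν + 15379 / (3 * ν) ≤ 0.00925 := by
    rw [div_add_div _ _ hν0.ne' (by positivity), div_le_iff₀ (by positivity)]
    nlinarith
  have hcoef : 0 ≤ 2.30 + 0.128 * L := by positivity
  have := mul_le_mul_of_nonneg_left h1 hcoef
  nlinarith

/-- Far term, regime B: an absolute constant, `2.82 ν² log T/(6πT³) ≤ 25.3` when `0 ≤ ν ≤ 13T`, `T ≥ 1`. -/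
theorem farB {ν T : ℝ} (hT : 1 ≤ T) (hν0 : 0 ≤ ν) (h13 : ν ≤ 13 * T) :
    2.82 * ν ^ 2 * (Real.log T / (6 * π * T ^ 3)) ≤ 25.3 := by
  have hπlo := Real.pi_gt_d4
  have hT0 : 0 < T := by linarith
  set ℓ := Real.log T with hℓ
  have hℓT : ℓ ≤ T := by
    have := Real.log_le_sub_one_of_pos hT0
    linarith
  have hℓ0 : 0 ≤ ℓ := Real.log_nonneg hT
  have hν2 : ν ^ 2 ≤ 169 * T ^ 2 := by nlinarith
  have h1 : 2.82 * ν ^ 2 * (ℓ / (6 * π * T ^ 3)) ≤ 2.82 * (169 * T ^ 2) * (ℓ / (6 * π * T ^ 3)) :=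
    mul_le_mul_of_nonneg_right (mul_le_mul_of_nonneg_left hν2 (by norm_num)) (by positivity)
  have e : 2.82 * (169 * T ^ 2) * (ℓ / (6 * π * T ^ 3)) = 2.82 * 169 / (6 * π) * (ℓ / T) := by
    field_simp
  have h2 : ℓ / T ≤ 1 := by rw [div_le_one hT0]; exact hℓT
  have h3 : 2.82 * 169 / (6 * π) ≤ 25.3 := by
    rw [div_le_iff₀ (by positivity)]; nlinarith
  have h4 : 0 ≤ ℓ / T := by positivity
  nlinarith [mul_le_mul h3 h2 h4 (by norm_num)]

/-- REGIME B (`2π(T − 4) < n < 13T`, window top `T₂ = n/13`). -/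
theorem caseB (n : ℕ) (T : ℝ) (hT : (10 : ℝ) ^ 5 ≤ T) (hlin : 2 * Real.pi * (T - 4) < n)
    (h13 : (n : ℝ) < 13 * T) :
    0 ≤ 2 * liWindowBound n (n / 13) - 2.82 * (n : ℝ) ^ 2 * (Real.log T / (6 * Real.pi * T ^ 3)) := by
  have hπlo := Real.pi_gt_d4
  have hT0 : 0 < T := by linarith [show (0 : ℝ) < 10 ^ 5 by norm_num]
  unfold liWindowBound
  set ν : ℝ := (n : ℝ) with hν
  have hνlo : 628000 ≤ ν := by nlinarith
  have hν0 : 0 < ν := by linarith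
  -- algebra of the window terms at `T₂ = n/13`
  have e1 : (ν / 13) ^ 2 / ν = ν / 169 := by field_simp; ring
  have e2 : 4 * ν / (ν / 13) ^ 2 = 676 / ν := by field_simp; ring
  have e3 : 7 / 3 * ν ^ 2 / (ν / 13) ^ 3 = 15379 / (3 * ν) := by field_simp; ring
  rw [e1, e2, e3]
  set L : ℝ := Real.log (ν / 13 / (2 * π)) with hL
  set ℓs : ℝ := Real.log (ν / 13) with hℓs
  have hℓsL : ℓs = L + Real.log (2 * π) := by
    rw [hL, Real.log_div (by positivity) (by positivity)]; ring
  have hL8 : 8 ≤ L := eight_le_L hνlo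
  have hℓsle : ℓs ≤ L + 2 := by linarith [log_two_pi_crude.2]
  have hmain := mainB hν0 (show (0.31 : ℝ) ≤ L by linarith)
  have hsec : 0.36 * (ν / 169) * L ≤ 0.0021302 * (ν * L) := by
    have : 0 ≤ ν * L := by nlinarith
    nlinarith
  have hS := sB hνlo (by linarith : 0 ≤ L)
  have hfar := farB (by linarith : (1 : ℝ) ≤ T) hν0.le h13.le
  have hprod : 8 * ν + 320 * L - 2560 ≤ ν * L := by
    nlinarith [mul_nonneg (show (0:ℝ) ≤ ν - 320 by linarith) (show (0:ℝ) ≤ L - 8 by linarith)]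
  linarith only [hmain, hsec, hS, hfar, hprod, hℓsle, hνlo, hL8]

end Budget

/-- **Crux `LiHeightBudget` (L6, the closed real inequality of the Li height law).**  For `T ≥ 10⁵`,
`2π(T − 4) < n ≤ T²/5` and `T₂ = min(T, n/13)`: `0 ≤ 2·liWindowBound n T₂ − 2.82 n² log T/(6π T³)`
(regime A `n ≥ 13T` with `T₂ = T`, regime B `n < 13T` with `T₂ = n/13`). -/
theorem liHeightBudget_bound :
    ∀ (n : ℕ) (T : ℝ), (10 : ℝ) ^ 5 ≤ T → 2 * Real.pi * (T - 4) < n → (n : ℝ) ≤ 1 / 5 * T ^ 2 →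
      0 ≤ 2 * Summit.RiemannHypothesis.RiemannHypothesis.Theorems.LiTheory.liWindowBound n (min T (n / 13))
        - 2.82 * (n : ℝ) ^ 2 * (Real.log T / (6 * Real.pi * T ^ 3)) := by
  intro n T hT hlin hnc
  by_cases h : 13 * T ≤ n
  · have hmin : min T ((n : ℝ) / 13) = T := min_eq_left (by
      rw [le_div_iff₀ (by norm_num : (0 : ℝ) < 13)]; linarith)
    rw [hmin]
    exact Budget.caseA n T hT h hnc
  · rw [not_le] at h
    have hmin : min T ((n : ℝ) / 13) = n / 13 := min_eq_right (by
      rw [div_le_iff₀ (by norm_num : (0 : ℝ) < 13)]; linarith)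
    rw [hmin]
    exact Budget.caseB n T hT hlin h
end Summit.RiemannHypothesis.RiemannHypothesis.Theorems.LiTheory

end
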